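import Mathlib
import Summits.Ventures.PercRepro2.TwoHullMasterCubeConjecture

/-!
# Edge induction for the cube-cover conjecture (blind cell PercRepro2, night-4 g41, 2026-08-29;
proofs/NIGHT4-G41.md §2)

THE REDUCTION. Build the graph one edge at a time and refine the cube cover along the way: a block
of the old graph is REFINED along the new edge when a family of blocks of the new graph partitions
its surviving points (the points of the old block with no monochromatic `l`–`h` connection in the
new graph).  Refining every block of a cover gives a cover of the new graph
(`cubeCover_of_refinement`); the edgeless graph is one full cube (`cubeBlock_loops`).  Hence the
cube-cover conjecture follows from a LOCAL REFINEMENT PRINCIPLE for any class of blocks that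
contains the full cube of the edgeless graph and is closed under refinement along a new edge
(`cubeCoverConjecture_of_refinement`).

THE LOOP TRICK.  To keep one configuration type while edges are added, an absent edge is a loop
`s(l, l)`: a loop is invisible (`openGraph_update_loop_le`: no open adjacency uses it), so the
graph `Function.update ends e₀ p` «adds» the edge `e₀` with endpoints `p` to a graph in which `e₀`
was a loop; the configurations of both graphs are the same `Config E`, and the survivors of a
block are its points with no monochromatic connection in the new graph.  `loopify ends S` is the
graph with the edges of `S` and loops elsewhere; `Finset.induction_on` over `S` is the induction.

Census behind the principle (own code mining/night-4/g41/, NIGHT4-G41.md §1): for every graph on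
`n ≤ 5` vertices (every edge subset of `K₅`, every ordered pair of non-adjacent marks, 21,260
cases) a chain of INHERITED refinements (the class partition of a new block coarsens the old one)
exists; the greedy rule «coarsest refinement, the new edge in the smallest classes» builds it
without backtracking in 10,610 / 10,610 cases with the edges in breadth-first order from `h`.

* `Refinement`, `cubeCover_of_refinement`;
* `cubeBlock_loops`, `loopify`, `loopify_insert`;
* **`cubeCoverConjecture_of_refinement`**.
-/

namespace Summit.Ventures.PercRepro2

namespace Blocks

open Hull LocRows

open scoped Classical

variable {V : Type*} {E : Type*} [DecidableEq E]

/-! ## §1 Loops are invisible -/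

/-- Replacing a loop by an edge can only add open adjacencies. -/
lemma openGraph_update_loop_le {ends : E → Sym2 V} {e₀ : E} {x : V} (h₀ : ends e₀ = s(x, x))
    (p : Sym2 V) (ω : Config E) : openGraph ends ω ≤ openGraph (Function.update ends e₀ p) ω := by
  intro u v huv
  rw [openGraph_adj] at huv ⊢
  obtain ⟨hne, e, he, hends⟩ := huv
  refine ⟨hne, e, he, ?_⟩
  by_cases hee : e = e₀
  · subst hee
    rw [h₀, Sym2.eq_iff] at hends
    exact absurd (by rcases hends with ⟨h1, h2⟩ | ⟨h1, h2⟩ <;> rw [← h1, ← h2]) hne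
  · rw [Function.update_of_ne hee, hends]

/-- Connection is preserved when a loop becomes an edge. -/
lemma conn_update_loop {ends : E → Sym2 V} {e₀ : E} {x : V} (h₀ : ends e₀ = s(x, x))
    (p : Sym2 V) {ω : Config E} {u v : V} (hc : Conn ends ω u v) :
    Conn (Function.update ends e₀ p) ω u v :=
  SimpleGraph.Reachable.mono (openGraph_update_loop_le h₀ p ω) hc

/-- The hull can only grow when a loop becomes an edge. -/
lemma hull_update_loop_subset {ends : E → Sym2 V} {e₀ : E} {x : V} (h₀ : ends e₀ = s(x, x))
    (p : Sym2 V) (ζ : Config E) (l : V) :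
    hull ends ζ l ⊆ hull (Function.update ends e₀ p) ζ l := by
  rintro y (hy | hy)
  · exact Or.inl (conn_update_loop h₀ p hy)
  · exact Or.inr (conn_update_loop h₀ p hy)

omit [DecidableEq E] in
/-- A graph of loops has no open adjacency at all. -/
lemma openGraph_loops_eq_bot {ends : E → Sym2 V} {l : V} (hl : ∀ e, ends e = s(l, l))
    (ω : Config E) : openGraph ends ω = ⊥ := by
  ext u v
  simp only [SimpleGraph.bot_adj, iff_false]
  intro huv
  rw [openGraph_adj] at huv
  obtain ⟨hne, e, _, hends⟩ := huv
  rw [hl e, Sym2.eq_iff] at hends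
  exact hne (by rcases hends with ⟨h1, h2⟩ | ⟨h1, h2⟩ <;> rw [← h1, ← h2])

omit [DecidableEq E] in
/-- In a graph of loops every cluster is a singleton. -/
lemma cluster_loops {ends : E → Sym2 V} {l : V} (hl : ∀ e, ends e = s(l, l)) (ω : Config E)
    (v : V) : cluster ends ω v = {v} := by
  ext u
  simp only [mem_cluster, Set.mem_singleton_iff]
  constructor
  · intro hc
    have hc' : (⊥ : SimpleGraph V).Reachable v u := by
      rw [← openGraph_loops_eq_bot hl ω]
      exact hc
    exact (SimpleGraph.reachable_bot.1 hc').symm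
  · rintro rfl
    exact conn_refl ends ω u

omit [DecidableEq E] in
/-- In a graph of loops every hull pair is the constant `({v}, {v})`. -/
lemma hullPair_loops {ends : E → Sym2 V} {l : V} (hl : ∀ e, ends e = s(l, l)) (ω : Config E)
    (v : V) : hullPair ends ω v = ({v}, {v}) := by
  simp only [hullPair, cluster_loops hl]

omit [DecidableEq E] in
/-- **The edgeless graph is one full cube**: with loops only, every configuration is a point of
`U` and the identity parametrisation of the cube `E → Bool` is a monotone cube block. -/
theorem cubeBlock_loops {ends : E → Sym2 V} {l h : V} (hl : ∀ e, ends e = s(l, l)) (hlh : l ≠ h) :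
    CubeBlock ends l h (id : (E → Bool) → Config E) where
  inj := Function.injective_id
  mem := fun ε => by
    simp only [hull, cluster_loops hl, id, Set.union_self, Set.mem_singleton_iff]
    exact hlh.symm
  l_mono := fun ε ε' _ => by
    simp only [hullPair_loops hl]
    exact ⟨subset_rfl, subset_rfl⟩
  h_anti := fun ε ε' _ => by
    simp only [hullPair_loops hl]
    exact ⟨subset_rfl, subset_rfl⟩
  mirror := Or.inl fun ε => by simp only [hullPair_loops hl, Prod.swap]

/-! ## §2 Refinements -/

/-- **A refinement of a block along a new edge**: `ends'` is the new graph (the old one with the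
loop `e₀` replaced by an edge), `pt` the old block, `pt'` a family of blocks of the new graph whose
points lie in the old block and partition its survivors (the points with no monochromatic
`l`–`h` connection in the new graph). -/
structure Refinement (ends ends' : E → Sym2 V) (l h : V) {ι : Type*}
    (pt : (ι → Bool) → Config E) {γ : Type*} {ι' : γ → Type*}
    (pt' : ∀ c, (ι' c → Bool) → Config E) : Prop where
  /-- Every new block is a monotone cube block of the new graph. -/
  block : ∀ c, CubeBlock ends' l h (pt' c)
  /-- Every point of a new block is a point of the old block. -/
  sub : ∀ c ε', ∃ ε, pt' c ε' = pt ε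
  /-- Every surviving point of the old block lies in a new block. -/
  cover : ∀ ε, h ∉ hull ends' (pt ε) l → ∃ c ε', pt' c ε' = pt ε
  /-- Two new blocks sharing a point are the same block. -/
  disj : ∀ c c' ε' ε'', pt' c ε' = pt' c' ε'' → c = c'

variable {β : Type*} {ι : β → Type*} {pt : ∀ b, (ι b → Bool) → Config E}
  {γ : β → Type*} {ι' : ∀ b, γ b → Type*} {pt' : ∀ b c, (ι' b c → Bool) → Config E}

/-- The assembled family: a block of the refined cover is a block `c` of the refinement of a block
`b`. -/
def refinedPt (pt' : ∀ b c, (ι' b c → Bool) → Config E) (bc : Σ b, γ b)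
    (ε : ι' bc.1 bc.2 → Bool) : Config E :=
  pt' bc.1 bc.2 ε

/-- **Refining every block of a cube cover along a new edge gives a cube cover of the new graph**
(the old graph has a loop at `e₀`, the new one the edge `e₀` with endpoints `p`). -/
theorem cubeCover_of_refinement {ends : E → Sym2 V} {l h : V} {e₀ : E} {x : V}
    (h₀ : ends e₀ = s(x, x)) (p : Sym2 V) (hc : CubeCover ends l h pt)
    (href : ∀ b, Refinement ends (Function.update ends e₀ p) l h (pt b) (pt' b)) :
    CubeCover (Function.update ends e₀ p) l h (refinedPt pt') where
  block := fun bc => (href bc.1).block bc.2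
  cover := fun ζ hζ => by
    have hζ' : h ∉ hull ends ζ l := fun hh => hζ (hull_update_loop_subset h₀ p ζ l hh)
    obtain ⟨b, ε, rfl⟩ := hc.cover ζ hζ'
    obtain ⟨c, ε', hε'⟩ := (href b).cover ε hζ
    exact ⟨⟨b, c⟩, ε', hε'⟩
  disj := fun bc bc' ε ε' heq => by
    obtain ⟨b, c⟩ := bc
    obtain ⟨b', c'⟩ := bc'
    obtain ⟨δ, hδ⟩ := (href b).sub c ε
    obtain ⟨δ', hδ'⟩ := (href b').sub c' ε'
    simp only [refinedPt] at heq
    have hb : b = b' := hc.disj b b' δ δ' (by rw [← hδ, ← hδ', heq])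
    subst hb
    have hcc : c = c' := (href b).disj c c' ε ε' heq
    subst hcc
    rfl

/-! ## §3 The induction -/

/-- The graph with the edges of `S` and a loop at `l` elsewhere. -/
def loopify (ends : E → Sym2 V) (l : V) (S : Finset E) : E → Sym2 V :=
  fun e => if e ∈ S then ends e else s(l, l)

/-- `loopify` over the empty set is all loops. -/
lemma loopify_empty (ends : E → Sym2 V) (l : V) (e : E) : loopify ends l ∅ e = s(l, l) := by
  simp [loopify]

/-- `loopify` over everything is the graph itself. -/
lemma loopify_univ [Fintype E] (ends : E → Sym2 V) (l : V) :
    loopify ends l Finset.univ = ends := by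
  funext e
  simp [loopify]

/-- Inserting an edge into `S` replaces its loop by the edge. -/
lemma loopify_insert (ends : E → Sym2 V) (l : V) (S : Finset E) (e₀ : E) (h₀ : e₀ ∉ S) :
    loopify ends l (insert e₀ S) = Function.update (loopify ends l S) e₀ (ends e₀) := by
  funext e
  by_cases he : e = e₀
  · subst he
    simp [loopify]
  · simp [loopify, he]

/-- The loop of an absent edge. -/
lemma loopify_of_notMem (ends : E → Sym2 V) (l : V) (S : Finset E) (e₀ : E) (h₀ : e₀ ∉ S) :
    loopify ends l S e₀ = s(l, l) := by
  simp [loopify, h₀]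

/-- **The cube-cover conjecture from a local refinement principle.**  `Good` is any class of blocks
(of any finite graph, for any marks) such that (i) the full cube of the edgeless graph is `Good`
and (ii) every `Good` block of a graph with a loop at `e₀` has a refinement by `Good` blocks along
the edge `e₀` with any endpoints `p`.  Then every finite graph has a cube cover for every pair of
marks. -/
theorem cubeCoverConjecture_of_refinement
    (Good : ∀ {V E : Type} [Fintype V] [DecidableEq V] [Fintype E] [DecidableEq E],
      (E → Sym2 V) → V → V → ∀ {ι : Type}, ((ι → Bool) → Config E) → Prop)
    (hbase : ∀ {V E : Type} [Fintype V] [DecidableEq V] [Fintype E] [DecidableEq E]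
      (ends : E → Sym2 V) (l h : V), l ≠ h → (∀ e, ends e = s(l, l)) →
      Good ends l h (id : (E → Bool) → Config E))
    (hstep : ∀ {V E : Type} [Fintype V] [DecidableEq V] [Fintype E] [DecidableEq E]
      (ends : E → Sym2 V) (l h : V), l ≠ h → ∀ (e₀ : E) (p : Sym2 V), ends e₀ = s(l, l) →
      ∀ {ι : Type} [Fintype ι] (pt : (ι → Bool) → Config E), CubeBlock ends l h pt →
        Good ends l h pt →
        ∃ (γ : Type) (_ : Fintype γ) (ι' : γ → Type) (_ : ∀ c, Fintype (ι' c))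
          (pt' : ∀ c, (ι' c → Bool) → Config E),
          Refinement ends (Function.update ends e₀ p) l h pt pt' ∧
            ∀ c, Good (Function.update ends e₀ p) l h (pt' c)) :
    CubeCoverConjecture := by
  intro V E _ _ _ _ ends l h hlh
  -- the statement proved by induction on the edge set `S`
  suffices key : ∀ S : Finset E,
      ∃ (β : Type) (_ : Fintype β) (ι : β → Type) (_ : ∀ b, Fintype (ι b))
        (pt : ∀ b, (ι b → Bool) → Config E),
        CubeCover (loopify ends l S) l h pt ∧ ∀ b, Good (loopify ends l S) l h (pt b) by
    obtain ⟨β, hβ, ι, hι, pt, hc, _⟩ := key Finset.univ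
    rw [loopify_univ] at hc
    exact ⟨β, hβ, ι, hι, pt, hc⟩
  intro S
  induction S using Finset.induction_on with
  | empty =>
    refine ⟨Unit, inferInstance, fun _ => E, fun _ => inferInstance, fun _ => id, ?_, ?_⟩
    · refine ⟨fun _ => cubeBlock_loops (loopify_empty ends l) hlh, fun ζ _ => ⟨(), ζ, rfl⟩,
        fun b b' _ _ _ => Subsingleton.elim b b'⟩
    · intro _
      exact hbase _ l h hlh (loopify_empty ends l)
  | insert e₀ S h₀ ih =>
    obtain ⟨β, hβ, ι, hι, pt, hc, hgood⟩ := ih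
    have hloop : loopify ends l S e₀ = s(l, l) := loopify_of_notMem ends l S e₀ h₀
    choose γ hγ ι' hι' pt' href hgood' using fun b =>
      hstep (loopify ends l S) l h hlh e₀ (ends e₀) hloop (pt b) (hc.block b) (hgood b)
    rw [loopify_insert ends l S e₀ h₀]
    refine ⟨Σ b, γ b, inferInstance, fun bc => ι' bc.1 bc.2, fun bc => hι' bc.1 bc.2,
      refinedPt pt', cubeCover_of_refinement hloop (ends e₀) hc href, fun bc => hgood' bc.1 bc.2⟩

end Blocks

end Summit.Ventures.PercRepro2
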